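import Summits.KontsevichZagierPeriods.Zeta5Search.TwoTaleP15LineBoundDecay

/-!
# Line-bound bricks: arctan, polynomial × exponential majorants, `K·nᵏ ≤ e^{εn}` eventually

HONEST FRAMING: systematic search; no irrationality claim unless certified.

Cell pub-zeta5, T3 service (P1 g9) — generic real-analysis lemmas for the `δ`-free E5 assembly
(`TwoTaleP15LineBoundDecaySharp`): `abs_mul_arctan_div_le` (`|η·arctan(V/η)| ≤ |V|`),
`abs_prim_le` (one leg of the profile: `|prim η V| ≤ |V|(½log(484+η²)+2)` for `1 ≤ |V| ≤ 22`), `poly38_le_exp`,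
`integral_poly38_exp_le` (`∫(484+y²)³⁸e^{−b|y|} ≤ 76!(2/b)⁷⁶e^{11b}(4/b)`), `eventually_mul_pow_le_exp`.
-/

noncomputable section

open Real MeasureTheory Set Filter

namespace Summit.KontsevichZagierPeriods.Zeta5Search.TwoTaleLineBound

/-- `|η · arctan (V/η)| ≤ |V|`. -/
theorem abs_mul_arctan_div_le (η V : ℝ) : |η * Real.arctan (V / η)| ≤ |V| := by
  rcases eq_or_ne η 0 with h | h
  · subst h; simp
  · -- `arctan t ≤ t` for `t ≥ 0` (tree: `Literature.NumberTheory.LFunctions.arctan_le_self`, two lines via `Real.le_tan`)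
    have ale : ∀ t : ℝ, 0 ≤ t → Real.arctan t ≤ t := fun t ht => by
      have h := Real.le_tan (Real.arctan_nonneg.2 ht) (Real.arctan_lt_pi_div_two t)
      rwa [Real.tan_arctan] at h
    have key : ∀ x : ℝ, |Real.arctan x| ≤ |x| := by
      intro x
      rcases le_or_gt 0 x with hx | hx
      · rw [abs_of_nonneg (Real.arctan_nonneg.2 hx), abs_of_nonneg hx]; exact ale x hx
      · have := ale (-x) (neg_nonneg.2 hx.le)
        rw [Real.arctan_neg] at this
        rw [abs_of_neg (Real.arctan_lt_zero.2 hx), abs_of_neg hx]; exact this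
    calc |η * Real.arctan (V / η)| = |η| * |Real.arctan (V / η)| := abs_mul _ _
      _ ≤ |η| * |V / η| := mul_le_mul_of_nonneg_left (key _) (abs_nonneg _)
      _ = |V| := by rw [abs_div, mul_div_cancel₀ _ (abs_ne_zero.2 h)]

/-- One leg: `|prim η V| ≤ |V|·(½log(484+η²) + 2)` for `1 ≤ |V| ≤ 22`. -/
theorem abs_prim_le {η V : ℝ} (hV1 : 1 ≤ |V|) (hV2 : |V| ≤ 22) :
    |prim η V| ≤ |V| * (Real.log (484 + η ^ 2) / 2 + 2) := by
  unfold prim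
  have hVsq : 1 ≤ V ^ 2 + η ^ 2 := by nlinarith [sq_abs V, abs_nonneg V, sq_nonneg η]
  have hlog0 : 0 ≤ Real.log (V ^ 2 + η ^ 2) := Real.log_nonneg hVsq
  have hlog1 : Real.log (V ^ 2 + η ^ 2) ≤ Real.log (484 + η ^ 2) :=
    Real.log_le_log (by positivity) (by nlinarith [sq_abs V, abs_nonneg V])
  have h1 : |V * (Real.log (V ^ 2 + η ^ 2) / 2)| ≤ |V| * (Real.log (484 + η ^ 2) / 2) := by
    rw [abs_mul, abs_of_nonneg (by positivity : 0 ≤ Real.log (V ^ 2 + η ^ 2) / 2)]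
    exact mul_le_mul_of_nonneg_left (by linarith) (abs_nonneg _)
  have h2 := abs_mul_arctan_div_le η V
  calc |V * (Real.log (V ^ 2 + η ^ 2) / 2) - V + η * Real.arctan (V / η)|
      ≤ |V * (Real.log (V ^ 2 + η ^ 2) / 2) - V| + |η * Real.arctan (V / η)| := abs_add_le _ _
    _ ≤ (|V * (Real.log (V ^ 2 + η ^ 2) / 2)| + |V|) + |V| := by
        gcongr; exact (abs_sub _ _).trans (by rfl)
    _ ≤ |V| * (Real.log (484 + η ^ 2) / 2) + |V| + |V| := by linarith
    _ = |V| * (Real.log (484 + η ^ 2) / 2 + 2) := by ring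

/-- `(484 + y²)³⁸ ≤ (22 + |y|)⁷⁶ ≤ 76!·(2/b)⁷⁶·e^{(b/2)(22+|y|)}` (`b > 0`). -/
theorem poly38_le_exp {b : ℝ} (hb : 0 < b) (y : ℝ) :
    (484 + y ^ 2) ^ 38 ≤ (Nat.factorial 76 : ℝ) * (2 / b) ^ 76 * Real.exp (b / 2 * (22 + |y|)) := by
  have h : 484 + y ^ 2 ≤ (22 + |y|) ^ 2 := by nlinarith [abs_nonneg y, sq_abs y]
  have h1 : (484 + y ^ 2) ^ 38 ≤ (22 + |y|) ^ 76 :=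
    calc (484 + y ^ 2) ^ 38 ≤ ((22 + |y|) ^ 2) ^ 38 := pow_le_pow_left₀ (by positivity) h 38
      _ = (22 + |y|) ^ 76 := by rw [← pow_mul]
  have hx : 0 ≤ b / 2 * (22 + |y|) := by positivity
  have h2 := Real.pow_div_factorial_le_exp _ hx 76
  have hf : (0 : ℝ) < Nat.factorial 76 := by exact_mod_cast Nat.factorial_pos 76
  rw [div_le_iff₀ hf] at h2
  have e : (22 + |y|) ^ 76 = (2 / b) ^ 76 * (b / 2 * (22 + |y|)) ^ 76 := by
    rw [← mul_pow]; congr 1; field_simp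
  rw [e] at h1
  have h3 : 0 ≤ (2 / b) ^ 76 := by positivity
  have h4 := mul_le_mul_of_nonneg_left h2 h3
  calc (484 + y ^ 2) ^ 38 ≤ (2 / b) ^ 76 * (b / 2 * (22 + |y|)) ^ 76 := h1
    _ ≤ (2 / b) ^ 76 * (Real.exp (b / 2 * (22 + |y|)) * (Nat.factorial 76 : ℝ)) := h4
    _ = (Nat.factorial 76 : ℝ) * (2 / b) ^ 76 * Real.exp (b / 2 * (22 + |y|)) := by
        generalize (2 / b) ^ 76 = q; generalize b / 2 * (22 + |y|) = x; ring

/-- The majorant `(484+y²)³⁸ e^{−b|y|}` is integrable with `∫ ≤ 76!·(2/b)⁷⁶·e^{11b}·(4/b)` (`b > 0`). -/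
theorem integral_poly38_exp_le {b : ℝ} (hb : 0 < b) :
    Integrable (fun y : ℝ => (484 + y ^ 2) ^ 38 * Real.exp (-(b * |y|))) ∧
      ∫ y : ℝ, (484 + y ^ 2) ^ 38 * Real.exp (-(b * |y|)) ≤
        (Nat.factorial 76 : ℝ) * (2 / b) ^ 76 * Real.exp (11 * b) * (4 / b) := by
  set C : ℝ := (Nat.factorial 76 : ℝ) * (2 / b) ^ 76 * Real.exp (11 * b) with hC
  have hdom : ∀ y : ℝ, (484 + y ^ 2) ^ 38 * Real.exp (-(b * |y|)) ≤ C * Real.exp (-(b / 2 * |y|)) := by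
    intro y
    have h1 := poly38_le_exp hb y
    have he : (Nat.factorial 76 : ℝ) * (2 / b) ^ 76 * Real.exp (b / 2 * (22 + |y|)) * Real.exp (-(b * |y|)) =
        C * Real.exp (-(b / 2 * |y|)) := by
      rw [hC, mul_assoc, ← Real.exp_add, mul_assoc ((Nat.factorial 76 : ℝ) * (2 / b) ^ 76), ← Real.exp_add]
      congr 2; ring
    rw [← he]
    exact mul_le_mul_of_nonneg_right h1 (Real.exp_pos _).le
  have hI : Integrable (fun y : ℝ => C * Real.exp (-(b / 2 * |y|))) :=
    (integrable_exp_neg_mul_abs (by positivity : 0 < b / 2)).const_mul C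
  have hint : Integrable (fun y : ℝ => (484 + y ^ 2) ^ 38 * Real.exp (-(b * |y|))) := by
    refine Integrable.mono' hI ?_ ?_
    · exact (by fun_prop : Continuous fun y : ℝ => (484 + y ^ 2) ^ 38 * Real.exp (-(b * |y|))).aestronglyMeasurable
    · refine Filter.Eventually.of_forall fun y => ?_
      rw [Real.norm_eq_abs, abs_of_nonneg (by positivity)]
      exact hdom y
  refine ⟨hint, ?_⟩
  -- ∫ C e^{−(b/2)|y|} = C · (4/b)
  have hval : ∫ y : ℝ, Real.exp (-(b / 2 * |y|)) = 4 / b := by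
    have hb2 : 0 < b / 2 := by positivity
    rw [← integral_add_compl (measurableSet_Ioi (a := (0:ℝ))) (integrable_exp_neg_mul_abs hb2)]
    have h1 : ∫ y in Ioi (0:ℝ), Real.exp (-(b / 2 * |y|)) = ∫ y in Ioi (0:ℝ), Real.exp (-(b / 2) * y) := by
      refine setIntegral_congr_fun measurableSet_Ioi fun y hy => ?_
      rw [mem_Ioi] at hy; rw [abs_of_pos hy]; ring_nf
    have h2 : ∫ y in (Ioi (0:ℝ))ᶜ, Real.exp (-(b / 2 * |y|)) = ∫ y in Iic (0:ℝ), Real.exp ((b / 2) * y) := by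
      rw [compl_Ioi]
      refine setIntegral_congr_fun measurableSet_Iic fun y hy => ?_
      rw [mem_Iic] at hy; rw [abs_of_nonpos hy]; ring_nf
    rw [h1, h2, integral_exp_mul_Ioi (by linarith : -(b / 2) < 0), integral_exp_mul_Iic hb2]
    simp only [mul_zero, Real.exp_zero]
    field_simp
    ring
  calc ∫ y : ℝ, (484 + y ^ 2) ^ 38 * Real.exp (-(b * |y|)) ≤ ∫ y : ℝ, C * Real.exp (-(b / 2 * |y|)) :=
        integral_mono_of_nonneg (Filter.Eventually.of_forall fun y => by positivity) hI
          (Filter.Eventually.of_forall hdom)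
    _ = C * (4 / b) := by rw [integral_const_mul, hval]

/-- `K · nᵏ ≤ e^{εn}` eventually (`ε > 0`). -/
theorem eventually_mul_pow_le_exp (K : ℝ) (k : ℕ) {ε : ℝ} (hε : 0 < ε) :
    ∀ᶠ n : ℕ in atTop, K * (n : ℝ) ^ k ≤ Real.exp (ε * n) := by
  have ht : Tendsto (fun n : ℕ => Real.exp (ε / 2 * n)) atTop atTop :=
    Real.tendsto_exp_atTop.comp (tendsto_natCast_atTop_atTop.const_mul_atTop (by positivity))
  filter_upwards [ht.eventually_ge_atTop (max K 0 * ((Nat.factorial k : ℝ) * (2 / ε) ^ k))] with n hn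
  have hx : 0 ≤ ε / 2 * n := by positivity
  have h1 := Real.pow_div_factorial_le_exp _ hx k
  have hf : (0 : ℝ) < Nat.factorial k := by exact_mod_cast Nat.factorial_pos k
  rw [div_le_iff₀ hf] at h1
  have e : (n : ℝ) ^ k = (2 / ε) ^ k * (ε / 2 * n) ^ k := by rw [← mul_pow]; congr 1; field_simp
  have hq : 0 ≤ (2 / ε) ^ k := by positivity
  have hnk : (n : ℝ) ^ k ≤ (Nat.factorial k : ℝ) * (2 / ε) ^ k * Real.exp (ε / 2 * n) := by
    rw [e]
    have := mul_le_mul_of_nonneg_left h1 hq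
    calc (2 / ε) ^ k * (ε / 2 * n) ^ k ≤ (2 / ε) ^ k * (Real.exp (ε / 2 * n) * (Nat.factorial k : ℝ)) := this
      _ = (Nat.factorial k : ℝ) * (2 / ε) ^ k * Real.exp (ε / 2 * n) := by
          generalize (2 / ε) ^ k = q; generalize Real.exp (ε / 2 * n) = E; ring
  have hK : K ≤ max K 0 := le_max_left _ _
  have hK0 : 0 ≤ max K 0 := le_max_right _ _
  have hE : 0 < Real.exp (ε / 2 * n) := Real.exp_pos _
  calc K * (n : ℝ) ^ k ≤ max K 0 * (n : ℝ) ^ k := mul_le_mul_of_nonneg_right hK (by positivity)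
    _ ≤ max K 0 * ((Nat.factorial k : ℝ) * (2 / ε) ^ k * Real.exp (ε / 2 * n)) := mul_le_mul_of_nonneg_left hnk hK0
    _ = (max K 0 * ((Nat.factorial k : ℝ) * (2 / ε) ^ k)) * Real.exp (ε / 2 * n) := by ring
    _ ≤ Real.exp (ε / 2 * n) * Real.exp (ε / 2 * n) := mul_le_mul_of_nonneg_right hn hE.le
    _ = Real.exp (ε * n) := by rw [← Real.exp_add]; congr 1; ring

end Summit.KontsevichZagierPeriods.Zeta5Search.TwoTaleLineBound

end
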